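import Literature.Probability.FitznerVanDerHofstad2017.BlockSummationVec
import HarnessLib

/-!
# [FvdH17] §6.2.1, Lemma 6.1 at `M = N − 1`: from per-class pointwise bounds of the `N`-level chain to the
# `recP` form of the `x`-space bound — the regrouping step, PROVED in abstract form

Source: R. Fitzner, R. van der Hofstad, *Mean-field behavior for nearest-neighbor percolation in `d > 10`*,
Electron. J. Probab. **22** (2017) no. 43 [FvdH17]; arXiv:1506.07977v2 §6.2.1 (6.48)–(6.51) and the proof of
Lemma 6.1 (pp. 65–67): "Performing a consideration of cases for `a_i`, as was done in the proof of Lemma 5.1 … To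
prove the bounds for all `N` we use induction on `N`."; §6.1 after (6.4) (p. 58): "we replace the bond `b₀` by
`(u, u + e_ι)`"; §5.1 (5.4) (p. 48) (the internal pair `(t,z)` of a middle block is summed inside the block).

What this module proves (pure `[0,∞]` bookkeeping over abstract sites `G`, classes `ι`, directions `K`; NOTHING here
is a cited hypothesis).  Data of a chain of `M+2` pivotal levels: pivotal bonds `b_i = (u_i, v_i)` and attachment
vertices `w_i`, `i ≤ M+1`, and the internal pairs `(t_i, z_i)` of the levels `1, …, M+2`.  If a quantity `Ξ` is
bounded by `Σ_{b,w,t,z} P(b,w,t,z)` (`hΞ` — the shape of the nested-pivotal union bound), every weight `P` is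
bounded class by class by the chain product with bond indicators,
`P ≤ Σ_κ ∏_i 𝟙{v_i = u_i + e_{κ_i}} Σ_{a,c} S(a_0,u_0,w_0) ∏_{i≤M} Bpt(κ_i,a_i,a_{i+1},u_i,w_i,t_i,z_i,u_{i+1},w_{i+1})
T(κ_{M+1},a_{M+1},c,u_{M+1},w_{M+1},t_{M+1},z_{M+1})` (`hP` — the shape delivered by the per-class estimates), and the
middle pieces sum to the blocks, `Σ_{t,z} Bpt(κ,a,a',u,w,t,z,u',w') ≤ B(κ,a,a',u,w,w',u')` (`hB`), then
`Ξ ≤ Σ_{u,w,t,z} Σ_{κ,a,c} P^{(M+1),a}(u,w) T(κ,a,c,u,w,t,z)` with `P^{(M+1)} = recP S B (M+1)` of (6.48)–(6.49):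
`le_tsum_recP_mul_of_chainBound`, and with `T = A·E` split, `le_tsum_recP_mul_mul_of_chainBound` — literally the
hypothesis `hΞ` of `BlockSummation.tsum_le_vecMul_pow_dotProduct` at one `x`.  The proof is three moves: the bond sums
collapse (`tsum_bond_collapse₃`), the internal pairs of the middle levels are summed inside their blocks
(`tsum_pair_chain_le`, via the product rule `tsum_vec_pair_prod`), and the last level is peeled off all data vectors
(`tsum_vec_pair_succ`, `sum_vec_pair_succ`, `tsum_vec_levelData_succ`) so that the remaining chain is
`recP S B (M+1)` by the closed form `BlockSummationVec.recP_eq_tsum_prod`.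
-/

noncomputable section

namespace Literature.Probability.FitznerVanDerHofstad2017.BlockSummation

open scoped ENNReal BigOperators

section ChainBound

variable {G ι K : Type*}

/-! ### A. Three more Fin-vector tools -/

/-- The components of a `snoc`-extended vector of level data are the `snoc`-extended components. [folklore] -/
theorem comp_snoc {D α : Type*} {n : ℕ} (π : D → α) (δ : Fin n → D) (dL : D) :
    (fun i => π (Fin.snoc (α := fun _ => D) δ dL i)) = Fin.snoc (α := fun _ => α) (fun i => π (δ i)) (π dL) := by
  funext i
  refine Fin.lastCases ?_ (fun j => ?_) i
  · simp only [Fin.snoc_last]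
  · simp only [Fin.snoc_castSucc]

variable [Fintype ι] [Fintype K]

/-- Bundling the four vectors of level data into one vector of bundled data. [folklore] -/
theorem tsum_vec_levelData {n : ℕ} (F : (Fin n → G) → (Fin n → G) → (Fin n → K) → (Fin n → ι) → ℝ≥0∞) :
    ∑' u : Fin n → G, ∑' w : Fin n → G, ∑ κ : Fin n → K, ∑ a : Fin n → ι, F u w κ a =
      ∑' δ : Fin n → G × G × K × ι,
        F (fun i => (δ i).1) (fun i => (δ i).2.1) (fun i => (δ i).2.2.1) (fun i => (δ i).2.2.2) := by
  symm
  rw [tsum_vec_prod]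
  refine tsum_congr fun u => ?_
  rw [tsum_vec_prod]
  refine tsum_congr fun w => ?_
  rw [tsum_vec_prod, tsum_vec_fintype]
  refine Finset.sum_congr rfl fun κ _ => ?_
  exact tsum_vec_fintype _

/-- **Peeling the last level off all four vectors of level data at once**:
`Σ_{u,w,κ,a : Fin (n+1) → ·} F = Σ_{u_L,w_L,κ_L,a_L} Σ_{u',w',κ',a' : Fin n → ·} F(snoc u' u_L, …)`. [folklore] -/
theorem tsum_vec_levelData_succ {n : ℕ}
    (F : (Fin (n + 1) → G) → (Fin (n + 1) → G) → (Fin (n + 1) → K) → (Fin (n + 1) → ι) → ℝ≥0∞) :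
    ∑' u : Fin (n + 1) → G, ∑' w : Fin (n + 1) → G, ∑ κ : Fin (n + 1) → K, ∑ a : Fin (n + 1) → ι, F u w κ a =
      ∑' uL : G, ∑' wL : G, ∑ κL : K, ∑ aL : ι,
        ∑' u : Fin n → G, ∑' w : Fin n → G, ∑ κ : Fin n → K, ∑ a : Fin n → ι,
          F (Fin.snoc (α := fun _ => G) u uL) (Fin.snoc (α := fun _ => G) w wL)
            (Fin.snoc (α := fun _ => K) κ κL) (Fin.snoc (α := fun _ => ι) a aL) := by
  rw [tsum_vec_levelData, tsum_vec_succ',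
    ← tsum_levelData (fun uL wL κL aL => ∑' u : Fin n → G, ∑' w : Fin n → G, ∑ κ : Fin n → K, ∑ a : Fin n → ι,
      F (Fin.snoc (α := fun _ => G) u uL) (Fin.snoc (α := fun _ => G) w wL)
        (Fin.snoc (α := fun _ => K) κ κL) (Fin.snoc (α := fun _ => ι) a aL))]
  refine tsum_congr fun dL => ?_
  rw [tsum_vec_levelData]
  refine tsum_congr fun δ => ?_
  rw [comp_snoc (fun d : G × G × K × ι => d.1), comp_snoc (fun d : G × G × K × ι => d.2.1),
    comp_snoc (fun d : G × G × K × ι => d.2.2.1), comp_snoc (fun d : G × G × K × ι => d.2.2.2)]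

/-- **Peeling the last level off a pair of vectors** (`tsum` version, last coordinates outside). [folklore] -/
theorem tsum_vec_pair_succ {β γ : Type*} {n : ℕ} (F : (Fin (n + 1) → β) → (Fin (n + 1) → γ) → ℝ≥0∞) :
    ∑' u : Fin (n + 1) → β, ∑' w : Fin (n + 1) → γ, F u w =
      ∑' uL : β, ∑' wL : γ, ∑' u : Fin n → β, ∑' w : Fin n → γ,
        F (Fin.snoc (α := fun _ => β) u uL) (Fin.snoc (α := fun _ => γ) w wL) := by
  calc ∑' u : Fin (n + 1) → β, ∑' w : Fin (n + 1) → γ, F u w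
      = ∑' u : Fin (n + 1) → β, ∑' wL : γ, ∑' w : Fin n → γ, F u (Fin.snoc (α := fun _ => γ) w wL) :=
        tsum_congr fun u => tsum_vec_succ' _
    _ = ∑' uL : β, ∑' u : Fin n → β, ∑' wL : γ, ∑' w : Fin n → γ,
          F (Fin.snoc (α := fun _ => β) u uL) (Fin.snoc (α := fun _ => γ) w wL) :=
        tsum_vec_succ' (F := fun u => ∑' wL : γ, ∑' w : Fin n → γ, F u (Fin.snoc (α := fun _ => γ) w wL))
    _ = _ := tsum_congr fun uL => ENNReal.tsum_comm

/-- **Peeling the last level off a pair of vectors** (finite-sum version, last coordinates outside). [folklore] -/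
theorem sum_vec_pair_succ {K' : Type*} [Fintype K'] {n : ℕ} (F : (Fin (n + 1) → K) → (Fin (n + 1) → K') → ℝ≥0∞) :
    ∑ κ : Fin (n + 1) → K, ∑ a : Fin (n + 1) → K', F κ a =
      ∑ κL : K, ∑ aL : K', ∑ κ : Fin n → K, ∑ a : Fin n → K',
        F (Fin.snoc (α := fun _ => K) κ κL) (Fin.snoc (α := fun _ => K') a aL) := by
  calc ∑ κ : Fin (n + 1) → K, ∑ a : Fin (n + 1) → K', F κ a
      = ∑ κ : Fin (n + 1) → K, ∑ a : Fin n → K', ∑ aL : K', F κ (Fin.snoc (α := fun _ => K') a aL) :=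
        Finset.sum_congr rfl fun κ _ => sum_vec_succ _
    _ = ∑ κ : Fin (n + 1) → K, ∑ aL : K', ∑ a : Fin n → K', F κ (Fin.snoc (α := fun _ => K') a aL) :=
        Finset.sum_congr rfl fun κ _ => Finset.sum_comm
    _ = ∑ κ : Fin n → K, ∑ κL : K, ∑ aL : K', ∑ a : Fin n → K',
          F (Fin.snoc (α := fun _ => K) κ κL) (Fin.snoc (α := fun _ => K') a aL) :=
        sum_vec_succ (F := fun κ => ∑ aL : K', ∑ a : Fin n → K', F κ (Fin.snoc (α := fun _ => K') a aL))
    _ = ∑ κL : K, ∑ κ : Fin n → K, ∑ aL : K', ∑ a : Fin n → K',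
          F (Fin.snoc (α := fun _ => K) κ κL) (Fin.snoc (α := fun _ => K') a aL) := Finset.sum_comm
    _ = _ := Finset.sum_congr rfl fun κL _ => Finset.sum_comm

/-- **Bond-sum collapse inside the chain**: summing the weights over the pivotal bonds `b_i = (u_i,v_i)` with the
indicators `𝟙{v_i = u_i + e_{κ_i}}` leaves the sum over the near endpoints `u_i`. [cite: FitznerVanDerHofstad2017, §6.1 after (6.4) (arXiv:1506.07977v2 p. 58)] -/
theorem tsum_vec_bond_collapse [Add G] [DecidableEq G] {n : ℕ} (e : K → G)
    (Φ : (Fin n → G) → (Fin n → K) → ℝ≥0∞) :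
    ∑' b : Fin n → G × G, ∑ κ : Fin n → K,
        (∏ i, if (b i).2 = (b i).1 + e (κ i) then (1 : ℝ≥0∞) else 0) * Φ (fun i => (b i).1) κ =
      ∑' u : Fin n → G, ∑ κ : Fin n → K, Φ u κ := by
  rw [tsum_vec_prod]
  refine tsum_congr fun u => ?_
  rw [tsum_finsetSum]
  refine Finset.sum_congr rfl fun κ _ => ?_
  exact tsum_vec_ite_eq (fun i => u i + e (κ i)) (fun _ => Φ u κ)

/-- The product rule for a pair of internal vectors: `Σ_{t,z : Fin n → G} ∏_i f_i(t_i,z_i) = ∏_i Σ_{x,y} f_i(x,y)`. [folklore] -/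
theorem tsum_vec_pair_prod {n : ℕ} (f : Fin n → G → G → ℝ≥0∞) :
    ∑' t : Fin n → G, ∑' z : Fin n → G, ∏ i, f i (t i) (z i) = ∏ i, ∑' x : G, ∑' y : G, f i x y := by
  rw [← tsum_vec_prod (F := fun q : Fin n → G × G => ∏ i, f i (q i).1 (q i).2),
    tsum_vec_prod_eq_prod_tsum n (fun i (p : G × G) => f i p.1 p.2)]
  refine Finset.prod_congr rfl fun i _ => ?_
  exact ENNReal.tsum_prod (f := fun (x : G) (y : G) => f i x y)

/-- Bond-sum collapse with three intervening sums (the shape of the joint event's parameter sum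
`Σ_{b} Σ_{w} Σ_{t} Σ_{z}`). [cite: FitznerVanDerHofstad2017, §6.1 after (6.4) (arXiv:1506.07977v2 p. 58)] -/
theorem tsum_bond_collapse₃ [Add G] [DecidableEq G] {n : ℕ} {α β γ : Type*} (e : K → G)
    (Φ : (Fin n → G) → (Fin n → K) → α → β → γ → ℝ≥0∞) :
    ∑' b : Fin n → G × G, ∑' w : α, ∑' t : β, ∑' z : γ, ∑ κ : Fin n → K,
        (∏ i, if (b i).2 = (b i).1 + e (κ i) then (1 : ℝ≥0∞) else 0) * Φ (fun i => (b i).1) κ w t z =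
      ∑' u : Fin n → G, ∑' w : α, ∑' t : β, ∑' z : γ, ∑ κ : Fin n → K, Φ u κ w t z := by
  rw [tsum_vec_prod]
  refine tsum_congr fun u => ?_
  rw [tsum_rot₄]
  refine tsum_congr fun w => tsum_congr fun t => tsum_congr fun z => ?_
  rw [tsum_finsetSum]
  refine Finset.sum_congr rfl fun κ _ => ?_
  exact tsum_vec_ite_eq (fun i => u i + e (κ i)) (fun _ => Φ u κ w t z)

/-- The middle internal pairs `(t_i, z_i)` summed out of a chain product: `Σ_{t,z} S·∏ f_i(t_i,z_i)·T ≤ S·∏ g_i·T`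
when `Σ_{x,y} f_i(x,y) ≤ g_i`. [cite: FitznerVanDerHofstad2017, §5.1 (5.4) (arXiv:1506.07977v2 p. 48)] -/
theorem tsum_pair_chain_le {n : ℕ} (Sc Tc : ℝ≥0∞) (f : Fin n → G → G → ℝ≥0∞) (g : Fin n → ℝ≥0∞)
    (h : ∀ i, ∑' x, ∑' y, f i x y ≤ g i) :
    ∑' t : Fin n → G, ∑' z : Fin n → G, Sc * (∏ i, f i (t i) (z i)) * Tc ≤ Sc * (∏ i, g i) * Tc := by
  have e1 : ∑' t : Fin n → G, ∑' z : Fin n → G, Sc * (∏ i, f i (t i) (z i)) * Tc =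
      Sc * (∑' t : Fin n → G, ∑' z : Fin n → G, ∏ i, f i (t i) (z i)) * Tc := by
    simp only [ENNReal.tsum_mul_left, ENNReal.tsum_mul_right]
  rw [e1, tsum_vec_pair_prod]
  exact mul_le_mul' (mul_le_mul' le_rfl (Finset.prod_le_prod' fun i _ => h i)) le_rfl

/-! ### B. The regrouping -/

/-- **From per-class pointwise bounds of the chain to the `recP` form** ([FvdH17] Lemma 6.1 at `M = N − 1`, the
regrouping behind "Performing a consideration of cases for `a_i` … induction on `N`").  Data of a chain of `M+2`
pivotal levels: bonds `b_i = (u_i,v_i)` and vertices `w_i`, `i ≤ M+1`, internal pairs `(t_i,z_i)` of the levels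
`1,…,M+2` (as `t (Fin.castSucc i)`, `i ≤ M`, and `t (Fin.last (M+1))`).  If `Ξ ≤ Σ P(b,w,t,z)` and every `P` is
bounded by `Σ_κ 𝟙{v_i = u_i + e_{κ_i} ∀ i} Σ_{a,c} S(a_0,u_0,w_0) ∏_{i≤M} Bpt(κ_i,a_i,a_{i+1},u_i,w_i,t_i,z_i,u_{i+1},w_{i+1})
T(κ_{M+1},a_{M+1},c,u_{M+1},w_{M+1},t_{M+1},z_{M+1})` with `Σ_{t,z} Bpt(…,t,z,u',w') ≤ B(…,w',u')`, then
`Ξ ≤ Σ_{u,w,t,z} Σ_{κ,a,c} P^{(M+1),a}(u,w) T(κ,a,c,u,w,t,z)`, `P^{(M+1)} = recP S B (M+1)`.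
[cite: FitznerVanDerHofstad2017, §6.2.1 (6.48)–(6.51), Lemma 6.1 and its proof (arXiv:1506.07977v2 pp. 65–67)] -/
theorem le_tsum_recP_mul_of_chainBound [Add G] [DecidableEq G]
    (S : ι → G → G → ℝ≥0∞) (B : K → ι → ι → G → G → G → G → ℝ≥0∞)
    (Bpt : K → ι → ι → G → G → G → G → G → G → ℝ≥0∞) (T : K → ι → ι → G → G → G → G → ℝ≥0∞)
    (e : K → G) (M : ℕ) (Ξ : ℝ≥0∞)
    (P : (Fin (M + 2) → G × G) → (Fin (M + 2) → G) → (Fin (M + 2) → G) → (Fin (M + 2) → G) → ℝ≥0∞)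
    (hΞ : Ξ ≤ ∑' b, ∑' w, ∑' t, ∑' z, P b w t z)
    (hP : ∀ b w t z, P b w t z ≤ ∑ κ : Fin (M + 2) → K,
      (∏ i, if (b i).2 = (b i).1 + e (κ i) then (1 : ℝ≥0∞) else 0) *
        ∑ a : Fin (M + 2) → ι, ∑ c : ι,
          S (a 0) (b 0).1 (w 0) *
            (∏ i : Fin (M + 1), Bpt (κ i.castSucc) (a i.castSucc) (a i.succ) (b i.castSucc).1 (w i.castSucc)
              (t i.castSucc) (z i.castSucc) (b i.succ).1 (w i.succ)) *
            T (κ (Fin.last (M + 1))) (a (Fin.last (M + 1))) c (b (Fin.last (M + 1))).1 (w (Fin.last (M + 1)))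
              (t (Fin.last (M + 1))) (z (Fin.last (M + 1))))
    (hB : ∀ κ a a' u w u' w', ∑' x, ∑' y, Bpt κ a a' u w x y u' w' ≤ B κ a a' u w w' u') :
    Ξ ≤ ∑' u, ∑' w, ∑' t, ∑' z, ∑ κ : K, ∑ a : ι, ∑ c : ι, recP S B (M + 1) a u w * T κ a c u w t z := by
  -- Step 1: the pointwise bound, and the bond sums collapse
  have h1 : Ξ ≤ ∑' u : Fin (M + 2) → G, ∑' w : Fin (M + 2) → G, ∑' t : Fin (M + 2) → G, ∑' z : Fin (M + 2) → G,
      ∑ κ : Fin (M + 2) → K, ∑ a : Fin (M + 2) → ι, ∑ c : ι,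
        S (a 0) (u 0) (w 0) *
          (∏ i : Fin (M + 1), Bpt (κ i.castSucc) (a i.castSucc) (a i.succ) (u i.castSucc) (w i.castSucc)
            (t i.castSucc) (z i.castSucc) (u i.succ) (w i.succ)) *
          T (κ (Fin.last (M + 1))) (a (Fin.last (M + 1))) c (u (Fin.last (M + 1))) (w (Fin.last (M + 1)))
            (t (Fin.last (M + 1))) (z (Fin.last (M + 1))) := by
    have key := tsum_bond_collapse₃ e (fun (u : Fin (M + 2) → G) (κ : Fin (M + 2) → K)
        (w : Fin (M + 2) → G) (t : Fin (M + 2) → G) (z : Fin (M + 2) → G) => ∑ a : Fin (M + 2) → ι, ∑ c : ι,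
        S (a 0) (u 0) (w 0) *
          (∏ i : Fin (M + 1), Bpt (κ i.castSucc) (a i.castSucc) (a i.succ) (u i.castSucc) (w i.castSucc)
            (t i.castSucc) (z i.castSucc) (u i.succ) (w i.succ)) *
          T (κ (Fin.last (M + 1))) (a (Fin.last (M + 1))) c (u (Fin.last (M + 1))) (w (Fin.last (M + 1)))
            (t (Fin.last (M + 1))) (z (Fin.last (M + 1))))
    beta_reduce at key
    rw [← key]
    exact hΞ.trans (ENNReal.tsum_le_tsum fun b => ENNReal.tsum_le_tsum fun w => ENNReal.tsum_le_tsum fun t =>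
      ENNReal.tsum_le_tsum fun z => hP b w t z)
  -- Step 2: the middle internal pairs are summed out level by level (`hB`)
  have h2 : Ξ ≤ ∑' u : Fin (M + 2) → G, ∑' w : Fin (M + 2) → G, ∑' tL : G, ∑' zL : G,
      ∑ κ : Fin (M + 2) → K, ∑ a : Fin (M + 2) → ι, ∑ c : ι,
        S (a 0) (u 0) (w 0) *
          (∏ i : Fin (M + 1), B (κ i.castSucc) (a i.castSucc) (a i.succ) (u i.castSucc) (w i.castSucc)
            (w i.succ) (u i.succ)) *
          T (κ (Fin.last (M + 1))) (a (Fin.last (M + 1))) c (u (Fin.last (M + 1))) (w (Fin.last (M + 1))) tL zL := by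
    refine h1.trans (ENNReal.tsum_le_tsum fun u => ENNReal.tsum_le_tsum fun w => ?_)
    rw [tsum_vec_succ']
    refine ENNReal.tsum_le_tsum fun tL => ?_
    refine (le_of_eq (tsum_congr fun t' => tsum_vec_succ' _)).trans ?_
    rw [ENNReal.tsum_comm]
    refine ENNReal.tsum_le_tsum fun zL => ?_
    simp only [Fin.snoc_castSucc, Fin.snoc_last, tsum_finsetSum]
    refine Finset.sum_le_sum fun κ _ => Finset.sum_le_sum fun a _ => Finset.sum_le_sum fun c _ => ?_
    exact tsum_pair_chain_le _ _ (fun i x y => Bpt (κ i.castSucc) (a i.castSucc) (a i.succ) (u i.castSucc)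
      (w i.castSucc) x y (u i.succ) (w i.succ)) _ (fun i => hB _ _ _ _ _ _ _)
  -- Step 3: peel the last level off the data and recognise `recP` in closed form (`recP_eq_tsum_prod`)
  rw [tsum_rot₄, tsum_rot₄] at h2
  -- (the peeling lemmas are instantiated at `n := M + 1` so that `simp` peels exactly one level)
  simp only [tsum_vec_pair_succ (n := M + 1), sum_vec_pair_succ (n := M + 1), snoc_apply_zero,
    Fin.snoc_castSucc, Fin.snoc_last, tsum_finsetSum] at h2
  rw [tsum_rot₄, tsum_rot₄]
  simp only [recP_eq_tsum_prod, snoc_apply_zero, Fin.snoc_castSucc, Finset.sum_mul, ← ENNReal.tsum_mul_right,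
    tsum_finsetSum]
  exact (h2.trans (le_of_eq (Finset.sum_congr rfl fun _ _ => Finset.sum_congr rfl fun _ _ =>
    Finset.sum_congr rfl fun _ _ => Finset.sum_comm))).trans
    (le_of_eq (Finset.sum_congr rfl fun _ _ => Finset.sum_congr rfl fun _ _ => Finset.sum_comm))

/-- The same with the tail split as "double-open piece × end piece", `T = A · E` — literally the hypothesis `hΞ` of
`BlockSummation.tsum_le_vecMul_pow_dotProduct` at one `x` (take `E c t z = P^{E,c}(z − x, t − x)`).
[cite: FitznerVanDerHofstad2017, Lemma 6.1 (6.51) at `M = N − 1` (arXiv:1506.07977v2 p. 66)] -/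
theorem le_tsum_recP_mul_mul_of_chainBound [Add G] [DecidableEq G]
    (S : ι → G → G → ℝ≥0∞) (B : K → ι → ι → G → G → G → G → ℝ≥0∞)
    (Bpt : K → ι → ι → G → G → G → G → G → G → ℝ≥0∞) (A : K → ι → ι → G → G → G → G → ℝ≥0∞)
    (E : ι → G → G → ℝ≥0∞) (e : K → G) (M : ℕ) (Ξ : ℝ≥0∞)
    (P : (Fin (M + 2) → G × G) → (Fin (M + 2) → G) → (Fin (M + 2) → G) → (Fin (M + 2) → G) → ℝ≥0∞)
    (hΞ : Ξ ≤ ∑' b, ∑' w, ∑' t, ∑' z, P b w t z)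
    (hP : ∀ b w t z, P b w t z ≤ ∑ κ : Fin (M + 2) → K,
      (∏ i, if (b i).2 = (b i).1 + e (κ i) then (1 : ℝ≥0∞) else 0) *
        ∑ a : Fin (M + 2) → ι, ∑ c : ι,
          S (a 0) (b 0).1 (w 0) *
            (∏ i : Fin (M + 1), Bpt (κ i.castSucc) (a i.castSucc) (a i.succ) (b i.castSucc).1 (w i.castSucc)
              (t i.castSucc) (z i.castSucc) (b i.succ).1 (w i.succ)) *
            A (κ (Fin.last (M + 1))) (a (Fin.last (M + 1))) c (b (Fin.last (M + 1))).1 (w (Fin.last (M + 1)))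
              (t (Fin.last (M + 1))) (z (Fin.last (M + 1))) *
            E c (t (Fin.last (M + 1))) (z (Fin.last (M + 1))))
    (hB : ∀ κ a a' u w u' w', ∑' x, ∑' y, Bpt κ a a' u w x y u' w' ≤ B κ a a' u w w' u') :
    Ξ ≤ ∑' u, ∑' w, ∑' t, ∑' z, ∑ κ : K, ∑ a : ι, ∑ c : ι,
      recP S B (M + 1) a u w * A κ a c u w t z * E c t z := by
  refine (le_tsum_recP_mul_of_chainBound S B Bpt (fun κ a c u w t z => A κ a c u w t z * E c t z) e M Ξ P hΞ
    (fun b w t z => (hP b w t z).trans (le_of_eq ?_)) hB).trans (le_of_eq ?_)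
  all_goals simp only [mul_assoc]

end ChainBound


end Literature.Probability.FitznerVanDerHofstad2017.BlockSummation
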